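import Mathlib.CategoryTheory.Abelian.Pseudoelements
import Literature.Algebra.Homology.StaircaseComplexes
import HarnessLib

/-!
# Torsion-free term identification: `q^{a}(T / q^{c} T) ≅ T / q^{c-a} T`

Companion to `Algebra/Homology/StaircaseComplexes` (generic homological algebra of the `p`-adic
staircase carriers of X. Hu's complexes). In an abelian category `𝒜`, for an object `T` WITHOUT
`q`-TORSION (`Mono ((q : ℤ) • 𝟙 T)`) and `a ≤ c`, multiplication by `q ^ a` induces a MONOMORPHISM
`T / q^{c-a} ⟶ T / q^{c}` (`reductionLift`, `mono_reductionLift` — a pseudoelement diagram chase) whose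
image is the image of `q ^ a` on `T / q^{c}`; whence the term identification of Hu's complexes
`p^{(r-j)M} Ωʲ_{X_{(r-j)N}} ≅ Ωʲ_{X_{(r-j)(N-M)}}` (X. Hu, arXiv:2507.12458, Def. 8.2, "since `Ωʲ_𝒳`
is `p`-torsion free") in the abstract form

* `isoImagePowSMul : cokernel (q^{c-a} • 𝟙 T) ≅ image (q^{a} • 𝟙 (cokernel (q^{c} • 𝟙 T)))`,
  compatible with the inclusions into `T / q^{c}` (`isoImagePowSMul_hom_ι`).

[folklore] Everything is proved; no named facts. NOT here: the assembly into an isomorphism of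
complexes `powImage (powQuotient K q c) q a ≅ powQuotient K q (c - a)` (the staircase differentials
pick up the factors `q^{a j - a (j+1)}`, so this is an isomorphism of GRADED objects intertwining
`d` with a rescaled `d`; state it when a consumer needs it).
-/

noncomputable section

namespace Literature.Algebra.Homology

open CategoryTheory CategoryTheory.Limits CategoryTheory.Abelian

universe v u

variable {𝒜 : Type u} [Category.{v} 𝒜] [Abelian 𝒜]

/-! ### Multiplication by powers of `q` -/

section

variable {T : 𝒜} (q : ℤ)

/-- `(qᵐ • 𝟙) ≫ (qⁿ • 𝟙) = qᵐ⁺ⁿ • 𝟙`. [folklore] -/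
@[reassoc]
theorem pow_smul_id_comp_pow_smul_id (m n : ℕ) :
    ((q ^ m : ℤ) • 𝟙 T) ≫ ((q ^ n : ℤ) • 𝟙 T) = (q ^ (m + n) : ℤ) • 𝟙 T := by
  rw [Preadditive.zsmul_comp, Category.id_comp, smul_smul, ← pow_add, add_comm]

/-- If `T` has no `q`-torsion (`q • 𝟙 T` mono) then `qⁿ • 𝟙 T` is mono for every `n`. [folklore] -/
theorem mono_pow_smul_id [Mono ((q : ℤ) • 𝟙 T)] (n : ℕ) : Mono ((q ^ n : ℤ) • 𝟙 T) := by
  induction n with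
  | zero => rw [pow_zero, one_smul]; infer_instance
  | succ n ih =>
    rw [← pow_smul_id_comp_pow_smul_id q n 1, pow_one]
    exact mono_comp _ _

/-- Multiplication by `qⁿ` commutes with every morphism. [folklore] -/
@[reassoc]
theorem pow_smul_id_comp {T' : 𝒜} (f : T ⟶ T') (n : ℕ) :
    ((q ^ n : ℤ) • 𝟙 T) ≫ f = f ≫ ((q ^ n : ℤ) • 𝟙 T') := by
  rw [Preadditive.zsmul_comp, Category.id_comp, Preadditive.comp_zsmul, Category.comp_id]

end

/-! ### The monomorphism `T / q^{c-a} ⟶ T / q^{c}` induced by `q ^ a` -/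

section

variable (T : 𝒜) (q : ℤ) {a c : ℕ} (hac : a ≤ c)

/-- The map `T / q^{c-a} T ⟶ T / q^{c} T` induced by multiplication by `q ^ a` (well defined as
`q^{c-a} · q^{a} = q^{c}`). [folklore] -/
def reductionLift : cokernel ((q ^ (c - a) : ℤ) • 𝟙 T) ⟶ cokernel ((q ^ c : ℤ) • 𝟙 T) :=
  cokernel.desc _ (((q ^ a : ℤ) • 𝟙 T) ≫ cokernel.π _) (by
    rw [pow_smul_id_comp_pow_smul_id_assoc, Nat.sub_add_cancel hac, cokernel.condition])

/-- `π_{c-a} ≫ reductionLift = q^{a} ≫ π_{c}`. [folklore] -/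
@[reassoc (attr := simp)]
theorem π_reductionLift :
    cokernel.π _ ≫ reductionLift T q hac = ((q ^ a : ℤ) • 𝟙 T) ≫ cokernel.π _ :=
  cokernel.π_desc _ _ _

/-- `q^{a} ≫ π_{c} = π_{c} ≫ q^{a}` (on `T / q^{c}`). [folklore] -/
@[reassoc]
theorem pow_smul_id_comp_cokernelπ (n : ℕ) :
    ((q ^ n : ℤ) • 𝟙 T) ≫ cokernel.π ((q ^ c : ℤ) • 𝟙 T) =
      cokernel.π ((q ^ c : ℤ) • 𝟙 T) ≫ ((q ^ n : ℤ) • 𝟙 _) :=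
  pow_smul_id_comp q _ n

open scoped Pseudoelement in
/-- **Torsion-freeness makes the induced map injective**: if `T` has no `q`-torsion then
`T / q^{c-a} ⟶ T / q^{c}` (multiplication by `q ^ a`) is a monomorphism. (Diagram chase with
pseudoelements: if `qᵃ t ∈ q^{c} T = qᵃ (q^{c-a} T)` then `t ∈ q^{c-a} T` because `qᵃ` is injective.)
[folklore] -/
theorem mono_reductionLift [Mono ((q : ℤ) • 𝟙 T)] : Mono (reductionLift T q hac) := by
  haveI : Mono ((q ^ a : ℤ) • 𝟙 T) := mono_pow_smul_id q a
  refine Pseudoelement.mono_of_zero_of_map_zero _ fun t ht ↦ ?_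
  obtain ⟨t₀, rfl⟩ := Pseudoelement.pseudo_surjective_of_epi (cokernel.π ((q ^ (c - a) : ℤ) • 𝟙 T)) t
  rw [← Pseudoelement.comp_apply, π_reductionLift, Pseudoelement.comp_apply] at ht
  obtain ⟨s, hs⟩ :=
    Pseudoelement.pseudo_exact_of_exact (ShortComplex.exact_cokernel ((q ^ c : ℤ) • 𝟙 T)) _ ht
  change ((q ^ c : ℤ) • 𝟙 T) s = ((q ^ a : ℤ) • 𝟙 T) t₀ at hs
  rw [← Nat.sub_add_cancel hac, ← pow_smul_id_comp_pow_smul_id q (c - a) a,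
    Pseudoelement.comp_apply] at hs
  have hs' : (((q ^ (c - a) : ℤ) • 𝟙 T) s : T) = t₀ :=
    Pseudoelement.pseudo_injective_of_mono ((q ^ a : ℤ) • 𝟙 T) hs
  rw [← hs', ← Pseudoelement.comp_apply, cokernel.condition, Pseudoelement.zero_apply]

/-! ### The image of `q ^ a` on `T / q^{c}` -/

/-- For an epimorphism `e`, `image (e ≫ g) ⟶ image g` (Mathlib's `image.preComp`) is an
isomorphism (abelian categories are balanced). [folklore] -/
theorem isIso_image_preComp_of_epi {X Y Z : 𝒜} (e : X ⟶ Y) [Epi e] (g : Y ⟶ Z) :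
    IsIso (image.preComp e g) := by
  haveI : Epi (image.preComp e g) := by
    haveI : Epi (factorThruImage (e ≫ g) ≫ image.preComp e g) := by
      rw [image.factorThruImage_preComp]
      exact epi_comp _ _
    exact epi_of_epi (factorThruImage (e ≫ g)) _
  exact isIso_of_mono_of_epi _

/-- **`T / q^{c-a} T ≅ qᵃ (T / q^{c} T)`** for `T` without `q`-torsion and `a ≤ c`: the source of the
monomorphism `reductionLift` identified with the image of multiplication by `q ^ a` on `T / q^{c}`.
(Term identification in X. Hu's complexes, arXiv:2507.12458, Def. 8.2.) [folklore] -/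
def isoImagePowSMul [Mono ((q : ℤ) • 𝟙 T)] :
    cokernel ((q ^ (c - a) : ℤ) • 𝟙 T) ≅
      image ((q ^ a : ℤ) • 𝟙 (cokernel ((q ^ c : ℤ) • 𝟙 T))) :=
  haveI := mono_reductionLift T q hac
  haveI := isIso_image_preComp_of_epi (cokernel.π ((q ^ (c - a) : ℤ) • 𝟙 T))
    (reductionLift T q hac)
  haveI := isIso_image_preComp_of_epi (cokernel.π ((q ^ c : ℤ) • 𝟙 T))
    ((q ^ a : ℤ) • 𝟙 (cokernel ((q ^ c : ℤ) • 𝟙 T)))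
  (imageMonoIsoSource (reductionLift T q hac)).symm ≪≫
    (asIso (image.preComp (cokernel.π _) (reductionLift T q hac))).symm ≪≫
      image.eqToIso ((π_reductionLift T q hac).trans (pow_smul_id_comp_cokernelπ T q a)) ≪≫
        asIso (image.preComp (cokernel.π ((q ^ c : ℤ) • 𝟙 T)) _)

/-- The identification is compatible with the inclusions into `T / q^{c}`:
`(iso).hom ≫ ι = reductionLift`. [folklore] -/
@[reassoc (attr := simp)]
theorem isoImagePowSMul_hom_ι [Mono ((q : ℤ) • 𝟙 T)] :
    (isoImagePowSMul T q hac).hom ≫ image.ι _ = reductionLift T q hac := by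
  haveI := mono_reductionLift T q hac
  haveI := isIso_image_preComp_of_epi (cokernel.π ((q ^ (c - a) : ℤ) • 𝟙 T))
    (reductionLift T q hac)
  haveI := isIso_image_preComp_of_epi (cokernel.π ((q ^ c : ℤ) • 𝟙 T))
    ((q ^ a : ℤ) • 𝟙 (cokernel ((q ^ c : ℤ) • 𝟙 T)))
  dsimp only [isoImagePowSMul]
  simp only [Iso.trans_hom, Iso.symm_hom, asIso_hom, asIso_inv, Category.assoc]
  rw [image.preComp_ι, ← image.eq_fac, ← image.preComp_ι (cokernel.π _) (reductionLift T q hac),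
    IsIso.inv_hom_id_assoc, imageMonoIsoSource_inv_ι]

end

end Literature.Algebra.Homology

end
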